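import Mathlib
import HarnessLib
import Literature.MathematicalPhysics.StatisticalMechanics.WeightIntegrationMapABKM
import Literature.MathematicalPhysics.StatisticalMechanics.WeightSectionDominatedQuadratic

/-!
# Lemma 8.4 (`ℓ = 0`) for the [ABKM19] weights on the torus: boundedness of the integration map
# `R_{k+1}` from `‖·‖_{k,X}` to `‖·‖_{k:k+1,X}` with constant `A^{|X|_k}`

Assembly of `TayNormLE.integral_comp_add_section` (Lemma 8.4 from weight-level hypotheses) with
the torus weight data: the weights `w_k^X = e^{½(φ, A_k^Xφ)}` are section-dominated under the
step measure for every gauge (`weightSectionDominated_expWeight`; `(1+η)A_k^X` stays subcritical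
for `η = θ̄/2` by the multiplier margin `c_{k+1}d_k ≤ (1+θ_k)⁻¹`), `w_k^X(φ+·)` is integrable
(`integrable_weight_abkm`) and satisfies (w7) (`integral_weight_abkm_le_map`).  Result:
**`tayNormLE_integral_abkm`** — if `‖K‖_{T, w_k^X} ≤ C_K` for a gauge `T`, `K` local and `C^{r₀}`,
then `‖∫ K(· + ξ) μ_{k+1}(dξ)‖_{T, w_{k:k+1}^X} ≤ C_K · weightIntConst^{|X|_k}` for `k`-polymers `X`
([ABKM19] Lemma 8.4 (8.5), `ℓ = 0`; the gauge change `X^* ↦ X^*` at the next scale is Lemma 8.1).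

Everything is proved; no named fact.

## References
* S. Adams, S. Buchholz, R. Kotecký, S. Müller, arXiv:1910.13564, Lemma 8.4, Theorem 7.1 (w7)
  [AdamsBuchholzKoteckyMuller2019].
-/

noncomputable section

namespace Literature.MathematicalPhysics.StatisticalMechanics.GradientRG

open Finset Matrix Real MeasureTheory ProbabilityTheory WithLp
open scoped MatrixOrder
open Literature.MathematicalPhysics.StatisticalMechanics.GradientFRD
  (iterDiff mulMat fourierCoeff cExt mulMat_smul posSemidef_mulMat posSemidef_mulMat_sub
    posDef_one_sub_sqrt_mul_mul_sqrt_mulMat)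
open Literature.MathematicalPhysics.StatisticalMechanics.TorusPolymer (IsPolymer numBlocks)
open Literature.MathematicalPhysics.QuantumFieldTheory

variable {d M : ℕ} [NeZero M]

/-- **`(1+η)A_k^X` is subcritical for the step covariance** when `(1+η) < 1 + θ̄` (margin
`c_{k+1}d_k ≤ (1+θ_k)⁻¹ ≤ (1+θ̄)⁻¹` of the multiplier tower).
[cite: AdamsBuchholzKoteckyMuller2019, Lemma 7.7 (7.71)] -/
theorem posDef_one_sub_smul_form (W : WeightData (Fin d → ZMod M)) {lam θbar η : ℝ}
    {θ : ℕ → ℝ} {m c t : ℕ → (Fin d → ZMod M) → ℝ}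
    (hD : W.Dominated fun k => mulMat (domMul lam θ m t k)) {k : ℕ}
    (hθbar : 0 < θbar) (hθ : θbar ≤ θ k) (hlam : 0 ≤ lam) (hη0 : 0 ≤ η) (hη : η < θbar)
    (hm_even : ∀ k κ, m k (-κ) = m k κ) (hm_nonneg : ∀ κ, 0 ≤ m k κ)
    (hc_even : ∀ κ, c (k + 1) (-κ) = c (k + 1) κ) (hc_nonneg : ∀ κ, 0 ≤ c (k + 1) κ)
    (ht_even : ∀ k κ, t k (-κ) = t k κ) (ht : ∀ κ, t k κ = c (k + 1) κ + t (k + 1) κ)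
    (ht_nonneg : ∀ κ, 0 ≤ t (k + 1) κ) (X : Finset (Fin d → ZMod M)) :
    ((1 : Matrix _ _ ℝ) - CFC.sqrt (mulMat (c (k + 1))) * ((1 + η) • W.form k X) *
      CFC.sqrt (mulMat (c (k + 1)))).PosDef := by
  -- the dominator `(1+η) • mulMat d_k = mulMat ((1+η) d_k)` is subcritical
  have hsub : ∀ κ, c (k + 1) κ * ((1 + η) * domMul lam θ m t k κ) < 1 := by
    intro κ
    have h1 : c (k + 1) κ * domMul lam θ m t k κ ≤ (1 + θ k)⁻¹ := by
      rw [domMul, ht κ]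
      exact cov_mul_domScalar_le hlam (hm_nonneg κ) (by linarith) (hc_nonneg κ) (ht_nonneg κ)
    have h2 : (1 + η) * (1 + θ k)⁻¹ < 1 := by
      rw [← div_eq_mul_inv, div_lt_one (by linarith)]; linarith
    have h0 : 0 ≤ c (k + 1) κ * domMul lam θ m t k κ :=
      mul_nonneg (hc_nonneg κ) (domScalar_nonneg hlam (by linarith) (hm_nonneg κ)
        (by rw [ht κ]; linarith [hc_nonneg κ, ht_nonneg κ]))
    nlinarith
  have hB := posDef_one_sub_sqrt_mul_mul_sqrt_mulMat (a := fun κ => (1 + η) * domMul lam θ m t k κ)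
    (fun κ => by simp only [domMul_neg hm_even ht_even]) hc_even hc_nonneg hsub
  rw [mulMat_smul] at hB
  have h12 : ((1 + η) • mulMat (domMul lam θ m t k) - (1 + η) • W.form k X).PosSemidef := by
    rw [← smul_sub]
    exact (WeightData.form_le hD k X).smul (by linarith : (0 : ℝ) ≤ 1 + η)
  exact posDef_one_sub_sqrt_mul_sqrt_anti h12 hB

/-- **[ABKM19] Lemma 8.4 (`ℓ = 0`) for the torus weights**: for the weight data `abkmWeightData`
(dominated by the multiplier sequence, `0 < θ̄ ≤ θ_k`), a scale `k` with `k + 1 ≤ N + 1`, a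
`k`-polymer `X`, any gauge `T`, and a local `C^{r₀}` functional `K` with
`‖K‖_{T, w_k^X} ≤ C_K` (`C_K ≥ 0`):
`‖∫ K(· + ξ) μ_{k+1}(dξ)‖_{T, w_{k:k+1}^X} ≤ C_K · weightIntConst^{|X|_k}`, `μ_{k+1} = stepMeasure 𝒞_{k+1}`.
[cite: AdamsBuchholzKoteckyMuller2019, Lemma 8.4] -/
theorem tayNormLE_integral_abkm {L N Mord R : ℕ} (hd : 2 ≤ d) (hMord : 1 ≤ Mord) (hMR : Mord ≤ R)
    (hLodd : Odd L) (hL : 2 ^ (d + 3) + 16 * R ≤ L) {θbar : ℝ} (hθbar : 0 < θbar) {δ' : ℕ → ℝ}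
    {𝒞 : ℕ → (Fin d → ZMod M) → ℝ} {lam : ℝ} (hlam : 0 < lam) {θ : ℕ → ℝ}
    (hθlo : ∀ k, θbar ≤ θ k)
    (hnn : ∀ (j : ℕ) (κ : Fin d → ZMod M), 0 ≤ cExt N (fun j => fourierCoeff (𝒞 j) κ) j)
    (hf_zero : ∀ j : ℕ, cExt N (fun j => fourierCoeff (𝒞 j) (0 : Fin d → ZMod M)) j = 0)
    (hf_even : ∀ (κ : Fin d → ZMod M) (j : ℕ), cExt N (fun j => fourierCoeff (𝒞 j) (-κ)) j =
      cExt N (fun j => fourierCoeff (𝒞 j) κ) j)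
    (hD : (abkmWeightData L N Mord R θbar δ' 𝒞).Dominated fun k =>
      mulMat (domMul lam θ (fun k => derivMul (L : ℝ) k (diffIndex d Mord))
        (tailMul N fun κ j => fourierCoeff (𝒞 j) κ) k))
    {k : ℕ} (hk : k + 1 ≤ N + 1) (heven : ∀ x, 𝒞 (k + 1) (-x) = 𝒞 (k + 1) x)
    {n : ℕ} (hn : 2 * Mord ≤ n) {Cα : (Fin d → ℕ) → ℕ → ℝ}
    (hreg : ∀ θ' : Fin d → ℕ, ∑ i, θ' i ≤ n → ∀ x,
      |iterDiff θ' (𝒞 (k + 1)) x| ≤ Cα θ' 0 / (L : ℝ) ^ ((k + 1 - 1) * (d - 2 + ∑ i, θ' i)))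
    {X : Finset (Fin d → ZMod M)} (hX : IsPolymer (L ^ k) X)
    {V : Type*} [NormedAddCommGroup V] [NormedSpace ℝ V] (T : ((Fin d → ZMod M) → ℝ) →ₗ[ℝ] V)
    {𝔸 : Type*} [NormedRing 𝔸] [NormedAlgebra ℝ 𝔸] [CompleteSpace 𝔸] {r₀ : ℕ}
    {K : ((Fin d → ZMod M) → ℝ) → 𝔸} {CK : ℝ} (hCK : 0 ≤ CK) (hKd : ContDiff ℝ r₀ K)
    (hKloc : IsGaugeLocal T K)
    (hK : TayNormLE T r₀ ((abkmWeightData L N Mord R θbar δ' 𝒞).weight k X) K CK) :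
    TayNormLE T r₀ ((abkmWeightData L N Mord R θbar δ' 𝒞).midWeight k X)
      (fun ψ => ∫ ξ, K (ψ + ξ) ∂(stepMeasure (𝒞 (k + 1))))
      (CK * weightIntConst θbar (traceConst d Mord R lam (derivSum d n Cα)) ^ numBlocks (L ^ k) X) := by
  set W := abkmWeightData L N Mord R θbar δ' 𝒞 with hW
  -- section domination of `w_k^X = expWeight (A_k^X)` with `η = θ̄/2`
  have hCeq := circulant_eq_mulMat_cExt hk heven (N := N)
  have hsub : ((1 : Matrix _ _ ℝ) - CFC.sqrt (Matrix.circulant (𝒞 (k + 1))) *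
      ((1 + θbar / 2) • W.form k X) * CFC.sqrt (Matrix.circulant (𝒞 (k + 1)))).PosDef := by
    rw [hCeq]
    exact posDef_one_sub_smul_form W (c := fun j κ => cExt N (fun j => fourierCoeff (𝒞 j) κ) j)
      hD hθbar (hθlo k) hlam.le (by linarith) (by linarith)
      (fun k κ => derivMul_neg _ k _ κ) (fun κ => derivMul_nonneg (Nat.cast_nonneg L) k _ κ)
      (fun κ => hf_even κ (k + 1)) (fun κ => hnn (k + 1) κ)
      (fun k κ => tailMul_neg_of_cExt hf_even k κ) (fun κ => tailMul_succ N _ k κ)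
      (fun κ => tailMul_nonneg (fun κ j => hnn j κ) (k + 1) κ) X
  have hwe : W.weight k X = expWeight (W.form k X) :=
    funext fun φ => WeightData.weight_eq_expWeight k X φ
  have hdom : WeightSectionDominated T (W.weight k X) (stepMeasure (𝒞 (k + 1))) := by
    rw [hwe]
    exact weightSectionDominated_expWeight T (C := Matrix.circulant (𝒞 (k + 1)))
      (WeightData.form_posSemidef hD k X) (η := θbar / 2) (by linarith) hsub
  exact hK.integral_comp_add_section hCK hKd hKloc hdom
    (integrable_weight_abkm hθbar.le hD hnn hk heven X)
    (integral_weight_abkm_le_map hd hMord hMR hLodd hL hθbar hlam hθlo hnn hf_zero hf_even hD hk heven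
      hn hreg hX)

end Literature.MathematicalPhysics.StatisticalMechanics.GradientRG

end
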